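import Literature.MathematicalPhysics.QuantumFieldTheory.Balaban1983to89.B9Eq376ProjPieceDirDictY

/-!
# `Balaban1983to89.B9Cor35CDirCubeNoLegHyp` — [Balaban1985BackgroundPropagators] Cor. 3.5 ∕ 3.6 pp. 407–408 for print's Dirichlet third cube letter `C_□`:
# FILES `B9Cor35CDirEngineAtCarrier.cor35_CDir_carrier` and `B9Cor35CDirAtCubeField.cor35_CDir_cube` RESTATED WITHOUT THE IDLE HYPOTHESIS «the knit cube legs at `Ṽ`
# are contractive» (it was threaded through but never used — the (3.19) letters `Q′_□`, `Q′*_□` enter Theorem 3.4's engines at `U = 1` only, where the legs are `1`)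
# (ROAD (I) U6f, hygiene; seat dag-n06-c g33)

statement-level skeleton of published theorems with citation tags; proofs where landed; nothing here is a claim about the Yang–Mills mass gap

## What this file does (mathematically)

Nothing new mathematically: the two theorems of FILES `B9Cor35CDirEngineAtCarrier` ∕ `B9Cor35CDirAtCubeField` are re-proved verbatim with one hypothesis fewer,
`∀ z w, ‖parKnitCubeY i □ Ṽ z w‖ ≤ 1 ∧ ‖(parKnitCubeY i □ Ṽ z w)⁻¹‖ ≤ 1`, which their proofs never consumed ([Balaban1985BackgroundPropagators] Thm 3.4 p. 400 takes
the (3.19) letters at `U`, here `U = 1`, and the (3.57) differences `Q′(U′U) − Q′(U)` only through the (3.59) sizes).  Consumers should cite ★★★ `cor35_CDir_carrier₀` ∕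
★★★ `cor35_CDir_cube₀`.

## Status

Printed-statement pass + proof body (proof-backed; assembly, copies of the landed proofs): [Balaban1985BackgroundPropagators] pp. 400–409, re-read 2026-08-31.
Honest label: hygiene restatement; the `A`-dependent (3.37)∕(3.59) data stay hypotheses.  Node N06 of the `pub-ymgap` DAG is NOT discharged here and the
Yang–Mills mass gap is NOT proved here.  NEW file; nothing landed is modified.  No `sorry`, no `axiom`, no `instance`, no `notation`.  Net new unproved facts: 0.
Cell `pub-ymgap` (HUMAN RULING D-0062), node N06 [B9], seat `pub-ymgap-dag-n06-c` (g33), 2026-08-31.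
RELATED, NOT DUPLICATED (searched 2026-08-31: `rg 'cor35_CDir_carrier₀|cor35_CDir_cube₀'` = ∅): the two originals (one hypothesis more; kept, importers unaffected).
-/

noncomputable section

namespace Literature.MathematicalPhysics.QuantumFieldTheory.Balaban1983to89.B9Cor35CDirCubeNoLegHyp

open B6KLevelCensusIndexV1 (KIdx kGeo)
open B6Cover236MultiLevelBlocks (cubes)
open B6RandomWalk (HasMajorant BlockSupp hasMajorant_mono Triangle254 Ineq261 c1_nonneg)
open B6RandomWalkHom (HasMajorantHom hasMajorantHom_mono)
open B9Thm34Ext (toB6)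
open B9Ineq347 (ScaleTransfer)
open B9Eq352DivFormLetters (conj)
open B9Eq352GradLetters (diffLetter)
open B9Eq360Vprime (gPrimeExtEnd)
open B9Eq360VprimeLetters (vPrimeConc)
open B9Eq39Adjoint (covD covDstar)
open B9Eq352DivForm (tauB)
open B9Thm34InvBlk (thm34_Cinv_uniform_blk)
open B9CubeLettersOpsL0 (oddMh cubeFamY)
open B9CubeLettersBondOpsL0 (BlkCubeY qpKc qpsKc QpCubeY QpsCubeY)
open B9Eq360DeltaPrimeAY (AfldY chartA)
open B9Eq360DeltaPrimeACubeY (blkCubeY kQCubeY sQCubeY kFCubeY sFCubeY)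
open B9CubeGeometryInputs (geoCK geoCK_len geoCK_eta geoCK_eta_pos geoCK_len_pos geoCK_eta_le_len geoCK_dist_axioms stencil_geoCK geoCK_site_nonempty hST_geoCK
  exists_h261_geoCK N1 RM1)
open B9Cor35GpCubeInputsAtOne (wK cfunK wK_nonneg card_block_mul_wK_le norm_kQCubeY_one_le norm_sQCubeY_one_le abs_cfunK_le)
open B9Cor35GpDirInputsAtOne (dirDomY GpDirK)
open B9Cor35GpDirAtCubeLetters (cor35_GpDir_cube)
open B9Cor35CinvAtCubeLetters (kernel_rate_mono)
open B9Cor36GpDirExtAtField (GextDirK_eq_GpDirVK)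
open B9Eq337CutFieldDirY (cutFldS cutCfgS)
open B9Eq360PadDeltaCubeYAgree (compr_sub_compr_eq_cutCfgS)
open B9CubeSequence408Mirrors (mem_dirDomC_of_lev_pos)
open B9Cor35CDirCarrierAtOne (SBlk QcR QcsR CinvR hLinv_CinvR thm32_CinvR)
open B9Cor35CDirCarrierQLetters (hasMajorantHom_QcR hasMajorantHom_QcsR FcR FcsR QcR_eq_add QcsR_eq_add hasMajorantHom_FcR hasMajorantHom_FcsR)
open B9Cor35CDirPaddedCarrier (eq_CinvR_of_laws)
open B9Cor35CDirWordAtField (word_at)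
open Node00 (SiteY CfgY toKT shiftY)
open Node00.OpsYLocalInverse (dirPadY)
open Node00.OpsYCubeDirInverse (GpDirY padDeltaCubeY)
open Node00.OpsYCubeDirInverseBond (indProjY)
open Node00.OpsYCubeKnitPar (parKnitCubeY parKnitCubeY_one)
open Node00.OpsYCubeProjectionG (XCubeGY)

variable {d ℓ : ℕ} {hd : 1 ≤ d + 1} {hL : Odd (ℓ + 1) ∧ 1 < ℓ + 1} {b₀ b₁ : ℝ}
variable {𝔸 : Type} [NormedRing 𝔸] [NormedAlgebra ℂ 𝔸] [CompleteSpace 𝔸]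
variable {ι : Type} [Fintype ι] (b : Module.Basis ι ℝ 𝔸)

/-- ★★★ **COROLLARY 3.5 FOR PRINT's DIRICHLET THIRD CUBE LETTER — THEOREM 3.4's `C`-CLAUSE AT `U = 1` ON THE CARRIER `𝔖 × ι`, UNIFORMLY IN THE MEMBER AND THE
COVER CUBE** (the engine's letters; all `A`-independent binders discharged) — FILE `B9Cor35CDirEngineAtCarrier.cor35_CDir_carrier` WITHOUT the idle knit-leg contractivity hypothesis at `Ṽ` (it was never used: the (3.19) letters enter at `U = 1` only).
[cite: Balaban1985BackgroundPropagators, Cor. 3.5 p.407, Thm 3.4 p.400, (3.65)–(3.67) p.403, Thm 3.2 (3.48) p.398, (3.57)–(3.60) pp.401–402, p.409 l.1–5; Balaban1984PropagatorsII, Prop. 2.3 p.238, Lemma 2.1 p.234] -/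
theorem cor35_CDir_carrier₀ [DecidableEq ι] (d ℓ : ℕ) (hℓ : 1 ≤ ℓ) (Cq M₂ : ℝ) (hCq : 0 ≤ Cq) (hM₂ : 0 ≤ M₂) (hrepr : ∀ (v : 𝔸) (j : ι), |b.repr v j| ≤ M₂ * ‖v‖)
    (h1 : ‖(1 : 𝔸)‖ ≤ 1) :
    ∃ δ B M₀ T₀ : ℝ, ∃ N₀ : ℕ, 0 < δ ∧ 0 < B ∧ ∃ a₁ : ℝ, 0 < a₁ ∧
    ∀ {hd : 1 ≤ d + 1} {hL : Odd (ℓ + 1) ∧ 1 < ℓ + 1} {b₀ b₁ : ℝ} (i : KIdx d ℓ hd hL b₀ b₁) (c : ↥(cubes (toKT i).D.toDomains)) (Rr : ℝ) (H : Prop),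
      M₀ ≤ ((ℓ : ℝ) + 1) * (toKT i).Mh → N₀ + 1 ≤ (toKT i).R * ((ℓ + 1) * (toKT i).Mh) → T₀ ≤ RM1 i →
    ∀ (α₁ : ℝ), 0 ≤ α₁ → α₁ ≤ a₁ →
    ∀ (A : Fin (d + 1) → SiteY i → 𝔸) (kF : BlkCubeY i c → SiteY i → 𝔸 →L[ℝ] 𝔸) (sF : SiteY i → 𝔸 →L[ℝ] 𝔸) (V : CfgY 𝔸 i),
      (∀ y x, blkCubeY i c x = y → ‖kF y x‖ ≤ Cq * α₁ * wK i c y) → (∀ x, ‖sF x‖ ≤ Cq * α₁) →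
      (∀ ν k x, ‖(((geoCK i c).eta : ℂ)⁻¹) • covDstar (shiftY i) (fun _ _ => (1 : 𝔸ˣ)) ν (A k) x‖ ≤ α₁ * ((geoCK i c).len (blkCubeY i c x) ^ 2)⁻¹) →
      (∀ k x, ‖A k x‖ ≤ α₁ * ((geoCK i c).len (blkCubeY i c x))⁻¹) →
      (∀ ν k x, ‖tauB (shiftY i) (fun _ _ => (1 : 𝔸ˣ)) ν (A k) x‖ ≤ α₁ * ((geoCK i c).len (blkCubeY i c x))⁻¹) →
      (∀ (s : BlkCubeY i c) (lam : SiteY i → 𝔸),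
        ‖(QpCubeY i c (parKnitCubeY i c) V lam - QpCubeY i c (parKnitCubeY i c) (fun _ _ => 1) lam) s‖ ≤ Cq * α₁ * ∑ z, |qpKc i c s z| * ‖lam z‖) →
      (∀ (z : SiteY i) (nu : BlkCubeY i c → 𝔸),
        ‖(QpsCubeY i c (parKnitCubeY i c) V nu - QpsCubeY i c (parKnitCubeY i c) (fun _ _ => 1) nu) z‖ ≤ Cq * α₁ * ∑ s, |qpsKc i c z s| * ‖nu s‖) →
    ∃ Tinv : Module.End ℝ (↥(SBlk i c) × ι → ℝ),
      Tinv * (QcR b i c V ∘ₗ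
        ((gPrimeExtEnd (GpDirK b i c (parKnitCubeY i c)) (conj b (vPrimeConc (shiftY i) (fun _ _ => (1 : 𝔸ˣ)) (geoCK i c).eta A (blkCubeY i c)
            (kQCubeY i c (parKnitCubeY i c) (fun _ _ => 1)) kF (sQCubeY i c (parKnitCubeY i c) (fun _ _ => 1)) sF (cfunK i c)) * GpDirK b i c (parKnitCubeY i c))) *
         (gPrimeExtEnd (GpDirK b i c (parKnitCubeY i c)) (conj b (vPrimeConc (shiftY i) (fun _ _ => (1 : 𝔸ˣ)) (geoCK i c).eta A (blkCubeY i c)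
            (kQCubeY i c (parKnitCubeY i c) (fun _ _ => 1)) kF (sQCubeY i c (parKnitCubeY i c) (fun _ _ => 1)) sF (cfunK i c)) * GpDirK b i c (parKnitCubeY i c)))) ∘ₗ
        QcsR b i c V) = 1 ∧
      (QcR b i c V ∘ₗ
        ((gPrimeExtEnd (GpDirK b i c (parKnitCubeY i c)) (conj b (vPrimeConc (shiftY i) (fun _ _ => (1 : 𝔸ˣ)) (geoCK i c).eta A (blkCubeY i c)
            (kQCubeY i c (parKnitCubeY i c) (fun _ _ => 1)) kF (sQCubeY i c (parKnitCubeY i c) (fun _ _ => 1)) sF (cfunK i c)) * GpDirK b i c (parKnitCubeY i c))) *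
         (gPrimeExtEnd (GpDirK b i c (parKnitCubeY i c)) (conj b (vPrimeConc (shiftY i) (fun _ _ => (1 : 𝔸ˣ)) (geoCK i c).eta A (blkCubeY i c)
            (kQCubeY i c (parKnitCubeY i c) (fun _ _ => 1)) kF (sQCubeY i c (parKnitCubeY i c) (fun _ _ => 1)) sF (cfunK i c)) * GpDirK b i c (parKnitCubeY i c)))) ∘ₗ
        QcsR b i c V) * Tinv = 1 ∧
      HasMajorant (g := toB6 (geoCK i c) Rr H) (fun q : ↥(SBlk i c) × ι => (q.1 : BlkCubeY i c)) Tinv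
        (fun a a' => B * (geoCK i c).len a ^ (-(4 : ℝ)) * Real.exp (-(δ * (geoCK i c).dist a a'))) := by
  classical
  have hSb : 0 ≤ ∑ j, ‖b j‖ := Finset.sum_nonneg fun j _ => norm_nonneg _
  -- UNIT 2: Theorem 3.1 for `GpDirK` in conj-`b` form; U6b-i: Theorem 3.2 for `CinvR 1` on the carrier
  obtain ⟨δG, BG, MG, TG, NG, hδG, hBG, aG, -, BB, -, hG⟩ := cor35_GpDir_cube b d ℓ hℓ Cq M₂ hCq hM₂ hrepr h1
  obtain ⟨δ₂, C₂, M₂', hδ₂, hC₂, -, h32⟩ := thm32_CinvR b d ℓ hℓ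
  -- one rate below both
  set δ₀ : ℝ := min δG δ₂ with hδ₀def
  have hδ₀ : 0 < δ₀ := lt_min hδG hδ₂
  have hδ₀1 : δ₀ ≤ δG := min_le_left _ _
  have hδ₀2 : δ₀ ≤ δ₂ := min_le_right _ _
  obtain ⟨dB, h261⟩ := exists_h261_geoCK d ℓ hδ₀
  have hΛf : ∀ α : ℝ, 0 < α → (1 : ℝ) ≤ ((ℓ : ℝ) + 1) ^ 4 := fun α _ =>
    one_le_pow₀ (by linarith [(Nat.cast_nonneg ℓ : (0 : ℝ) ≤ ℓ)])
  set κQ : ℝ := M₂ * (∑ j, ‖b j‖) + 1 with hκQdef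
  have hκQ : 0 < κQ := by rw [hκQdef]; nlinarith
  set cF : ℝ := M₂ * (∑ j, ‖b j‖) * Cq + 1 with hcFdef
  have hcF : 0 < cF := by rw [hcFdef]; nlinarith [mul_nonneg (mul_nonneg hM₂ hSb) hCq]
  obtain ⟨aC, haC, H34⟩ := thm34_Cinv_uniform_blk b (Fin (d + 1)) dB δ₀ κQ BG C₂ cF Cq 1 1 M₂ (fun _ => ((ℓ : ℝ) + 1) ^ 4) hκQ hBG hC₂ hcF hCq
    zero_le_one hM₂ hδ₀ hΛf hrepr
  have hc1 : 0 ≤ B6.c1 dB (2 / 5 * δ₀) (1 / 10) := c1_nonneg _ _ _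
  refine ⟨9 / 25 * δ₀, 2 * C₂ * B6.c1 dB (2 / 5 * δ₀) (1 / 10) + 1, max M₂' MG, max (4 * Real.log ((ℓ : ℝ) + 1) / (9 / 5000 * δ₀)) TG,
    max (N1 d ℓ (9 / 5000 * δ₀)) NG, by positivity, by positivity, aC, haC, ?_⟩
  intro hd hL b₀ b₁ i c Rr H hM hN hT α₁ hα0 hα1 A kF sF V hkF hsF h337B hA hAτB hF hFs
  -- thresholds
  have hM2 : M₂' ≤ ((ℓ : ℝ) + 1) * (toKT i).Mh := (le_max_left _ _).trans hM
  have hMG : MG ≤ ((ℓ : ℝ) + 1) * (toKT i).Mh := (le_max_right _ _).trans hM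
  have hN2 : N1 d ℓ (9 / 5000 * δ₀) + 1 ≤ (toKT i).R * ((ℓ + 1) * (toKT i).Mh) := le_trans (Nat.succ_le_succ (le_max_left _ _)) hN
  have hNG : NG + 1 ≤ (toKT i).R * ((ℓ + 1) * (toKT i).Mh) := le_trans (Nat.succ_le_succ (le_max_right _ _)) hN
  have hT2 : 4 * Real.log ((ℓ : ℝ) + 1) / (9 / 5000 * δ₀) ≤ RM1 i := (le_max_left _ _).trans hT
  have hTG : TG ≤ RM1 i := (le_max_right _ _).trans hT
  -- geometry of the cube sequence (r05 FILE 5a)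
  haveI : Nonempty (geoCK i c).Site := geoCK_site_nonempty i c
  obtain ⟨hdnn, htri, hrefl, hsym⟩ := geoCK_dist_axioms i c Rr H
  obtain ⟨hd₀B, hd₀F, hd₀0⟩ := stencil_geoCK i c
  -- Theorem 3.1 (3.42)₁,₂ for `GpDirK` at the knit cube legs, rate weakened to `δ₀` (UNIT 2 (b))
  obtain ⟨-, e1, e2, -, -⟩ := hG i c Rr H (parKnitCubeY i c) (parKnitCubeY_one i c) hMG hNG hTG
  have g342_1 : HasMajorant (g := toB6 (geoCK i c) Rr H) (fun p : SiteY i × ι => blkCubeY i c p.1) (GpDirK b i c (parKnitCubeY i c))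
      (fun a a' => BG * (geoCK i c).len a ^ 2 * Real.exp (-(δ₀ * (geoCK i c).dist a a'))) :=
    hasMajorant_mono (g := toB6 (geoCK i c) Rr H) _ e1 fun a a' => kernel_rate_mono hdnn hδ₀1 (mul_nonneg hBG.le (sq_nonneg _)) a a'
  have g342_2 : ∀ k : Fin (d + 1) ⊕ Fin (d + 1), HasMajorant (g := toB6 (geoCK i c) Rr H) (fun p : SiteY i × ι => blkCubeY i c p.1)
      (conj b (diffLetter (shiftY i) (fun _ _ => (1 : 𝔸ˣ)) ((((geoCK i c).eta : ℂ))⁻¹) k) * GpDirK b i c (parKnitCubeY i c))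
      (fun a a' => BG * (geoCK i c).len a * Real.exp (-(δ₀ * (geoCK i c).dist a a'))) := fun k =>
    hasMajorant_mono (g := toB6 (geoCK i c) Rr H) _ (e2 k) fun a a' => kernel_rate_mono hdnn hδ₀1 (mul_nonneg hBG.le (geoCK_len_pos i c a).le) a a'
  -- the (3.19) letters at `U = 1` on the carrier (U6b-ii), constant `κ_Q`
  have hκle : M₂ * (∑ j, ‖b j‖) ≤ κQ := by rw [hκQdef]; linarith
  have hpar1 : ∀ z w : SiteY i, ‖((parKnitCubeY i c (fun _ _ => 1) z w : 𝔸ˣ) : 𝔸)‖ ≤ 1 ∧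
      ‖(((parKnitCubeY i c (fun _ _ => 1) z w)⁻¹ : 𝔸ˣ) : 𝔸)‖ ≤ 1 := fun z w => by
    rw [parKnitCubeY_one i c z w, inv_one, Units.val_one]; exact ⟨h1, h1⟩
  have hQc := hasMajorantHom_mono (g := toB6 (geoCK i c) Rr H) _ _
    (hasMajorantHom_QcR b i c (fun _ _ => 1) (Rr := Rr) (Hp := H) hpar1 hM₂ hrepr)
    (K' := fun a a' : BlkCubeY i c => κQ * (if a = a' then (1 : ℝ) else 0)) fun a a' => by
      split_ifs
      · rw [mul_one]; exact hκle
      · rw [mul_zero]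
  have hQcs := hasMajorantHom_mono (g := toB6 (geoCK i c) Rr H) _ _
    (hasMajorantHom_QcsR b i c (fun _ _ => 1) (Rr := Rr) (Hp := H) hpar1 hM₂ hrepr)
    (K' := fun a a' : BlkCubeY i c => κQ * (if a = a' then (1 : ℝ) else 0)) fun a a' => by
      split_ifs
      · rw [mul_one]; exact hκle
      · rw [mul_zero]
  -- Theorem 3.2 at `U = 1` on the carrier (U6b-i): the law and the (3.48) majorant at the rate `δ₀`
  have hLinv := hLinv_CinvR b i c
  have h348 : HasMajorant (g := toB6 (geoCK i c) Rr H) (fun q : ↥(SBlk i c) × ι => (q.1 : BlkCubeY i c)) (CinvR b i c (fun _ _ => 1))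
      (fun a a' => C₂ * (geoCK i c).len a ^ (-(4 : ℝ)) * Real.exp (-(δ₀ * (geoCK i c).dist a a'))) :=
    hasMajorant_mono (g := toB6 (geoCK i c) Rr H) _ (h32 i c Rr H hM2)
      fun a a' => kernel_rate_mono hdnn hδ₀2 (mul_nonneg hC₂.le (Real.rpow_nonneg (geoCK_len_pos i c a).le _)) a a'
  -- the (3.57) letters on the carrier (U6b-ii), constant `c_F·α₁`
  have hcle : M₂ * (∑ j, ‖b j‖) * (Cq * α₁) ≤ cF * α₁ := by
    rw [hcFdef]; nlinarith [mul_nonneg (mul_nonneg hM₂ hSb) hCq]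
  have hFc := hasMajorantHom_mono (g := toB6 (geoCK i c) Rr H) _ _
    (hasMajorantHom_FcR b i c V (Rr := Rr) (Hp := H) hM₂ hrepr (by positivity) hF)
    (K' := fun a a' : BlkCubeY i c => cF * α₁ * (if a = a' then (1 : ℝ) else 0)) fun a a' => by
      split_ifs
      · rw [mul_one]; exact hcle
      · rw [mul_zero]
  have hFcs := hasMajorantHom_mono (g := toB6 (geoCK i c) Rr H) _ _
    (hasMajorantHom_FcsR b i c V (Rr := Rr) (Hp := H) hM₂ hrepr (by positivity) hFs)
    (K' := fun a a' : BlkCubeY i c => cF * α₁ * (if a = a' then (1 : ℝ) else 0)) fun a a' => by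
      split_ifs
      · rw [mul_one]; exact hcle
      · rw [mul_zero]
  -- r06's `C`-clause on the Dirichlet carrier `(𝔖 × ι, val ∘ fst)`
  obtain ⟨Tinv, hT1, hT2', hTm⟩ := H34 (shiftY i) (fun _ _ => (1 : 𝔸ˣ)) (g := geoCK i c) (Rr := Rr) (H := H) (blkCubeY i c)
    (fun q : ↥(SBlk i c) × ι => (q.1 : BlkCubeY i c)) (kQCubeY i c (parKnitCubeY i c) (fun _ _ => 1)) (sQCubeY i c (parKnitCubeY i c) (fun _ _ => 1))
    (cfunK i c) (wK i c)
    hdnn htri hrefl hsym (geoCK_len_pos i c) (geoCK_eta_le_len i c) (geoCK_eta_pos i c)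
    (fun α hα hα1 => h261 i c Rr H hN2 α hα hα1.le) (hST_geoCK i c hδ₀ hT2)
    (fun _ _ => ⟨h1, by rw [inv_one, Units.val_one]; exact h1⟩) hd₀B hd₀F hd₀0 (wK_nonneg i c) (card_block_mul_wK_le i c)
    (fun y x hx => by rw [← hx]; exact norm_kQCubeY_one_le i c (parKnitCubeY i c) h1 (parKnitCubeY_one i c) _ x)
    (norm_sQCubeY_one_le i c (parKnitCubeY i c) h1 (parKnitCubeY_one i c)) (abs_cfunK_le i c)
    g342_1 g342_2 hQc hQcs hLinv h348 α₁ hα0 hα1 A kF sF hkF hsF h337B hA hAτB (QcR_eq_add b i c V) (QcsR_eq_add b i c V) hFc hFcs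
  refine ⟨Tinv, hT1, hT2', hasMajorant_mono (g := toB6 (geoCK i c) Rr H) _ hTm fun a a' => ?_⟩
  have hℓ4 : 0 ≤ (geoCK i c).len a ^ (-(4 : ℝ)) := Real.rpow_nonneg (geoCK_len_pos i c a).le _
  have hexp : 0 ≤ Real.exp (-(9 / 25 * δ₀ * (geoCK i c).dist a a')) := (Real.exp_pos _).le
  nlinarith [mul_nonneg hℓ4 hexp]


/-- ★★★ **COROLLARY 3.5 ∕ 3.6 FOR PRINT's DIRICHLET THIRD CUBE LETTER AT THE SMALL FIELD OF A CUT POTENTIAL — THEOREM 3.2 FOR def-Y's `C_□(Ṽ)` ON THE BLOCKS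
INSIDE `Ω₀(□)`, UNIFORMLY IN THE MEMBER AND THE COVER CUBE** — FILE `B9Cor35CDirAtCubeField.cor35_CDir_cube` WITHOUT the idle knit-leg contractivity hypothesis.
[cite: Balaban1985BackgroundPropagators, Cor. 3.5 p.407, Cor. 3.6 p.408, Thm 3.4 p.400, p.403 l.8–12, Thm 3.2 (3.48) p.398, (3.57)–(3.60) pp.401–402, p.409 l.1–5; Balaban1984PropagatorsII, Prop. 2.3 (2.86)–(2.87) p.238, Lemma 2.1 p.234] -/
theorem cor35_CDir_cube₀ [DecidableEq ι] (d ℓ : ℕ) (hℓ : 1 ≤ ℓ) (Cq M₂ : ℝ) (hCq : 0 ≤ Cq) (hM₂ : 0 ≤ M₂) (hrepr : ∀ (v : 𝔸) (j : ι), |b.repr v j| ≤ M₂ * ‖v‖)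
    (h1 : ‖(1 : 𝔸)‖ ≤ 1) :
    ∃ δ B M₀ T₀ : ℝ, ∃ N₀ : ℕ, 0 < δ ∧ 0 < B ∧ ∃ a₁ : ℝ, 0 < a₁ ∧
    ∀ {hd : 1 ≤ d + 1} {hL : Odd (ℓ + 1) ∧ 1 < ℓ + 1} {b₀ b₁ : ℝ} (i : KIdx d ℓ hd hL b₀ b₁) (c : ↥(cubes (toKT i).D.toDomains)) (Rr : ℝ) (H : Prop),
      M₀ ≤ ((ℓ : ℝ) + 1) * (toKT i).Mh → N₀ + 1 ≤ (toKT i).R * ((ℓ + 1) * (toKT i).Mh) → T₀ ≤ RM1 i →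
    ∀ (α₁ : ℝ), 0 ≤ α₁ → α₁ ≤ a₁ →
    ∀ (A : AfldY 𝔸 i),
      (∀ y x, blkCubeY i c x = y →
        ‖kFCubeY i c (parKnitCubeY i c) (fun _ _ => 1) (cutCfgS i (dirDomY i c) (kGeo i).eta A) y x‖ ≤ Cq * α₁ * wK i c y) →
      (∀ x, ‖sFCubeY i c (parKnitCubeY i c) (fun _ _ => 1) (cutCfgS i (dirDomY i c) (kGeo i).eta A) x‖ ≤ Cq * α₁) →
      (∀ ν k x, ‖(((geoCK i c).eta : ℂ)⁻¹) • covDstar (shiftY i) (fun _ _ => (1 : 𝔸ˣ)) ν (chartA i (cutFldS i (dirDomY i c) A) k) x‖ ≤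
        α₁ * ((geoCK i c).len (blkCubeY i c x) ^ 2)⁻¹) →
      (∀ μ ν x, ‖(((geoCK i c).eta : ℂ)⁻¹) • covD (shiftY i) (fun _ _ => (1 : 𝔸ˣ)) μ (chartA i (cutFldS i (dirDomY i c) A) ν) x‖ ≤
        α₁ * ((geoCK i c).len (blkCubeY i c x) ^ 2)⁻¹) →
      (∀ μ x, ‖(((geoCK i c).eta : ℂ)⁻¹) • covDstar (shiftY i) (fun _ _ => (1 : 𝔸ˣ)) μ
          (tauB (shiftY i) (fun _ _ => (1 : 𝔸ˣ)) μ (chartA i (cutFldS i (dirDomY i c) A) μ)) x‖ ≤ α₁ * ((geoCK i c).len (blkCubeY i c x) ^ 2)⁻¹) →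
      (∀ k x, ‖chartA i (cutFldS i (dirDomY i c) A) k x‖ ≤ α₁ * ((geoCK i c).len (blkCubeY i c x))⁻¹) →
      (∀ ν k x, ‖tauB (shiftY i) (fun _ _ => (1 : 𝔸ˣ)) ν (chartA i (cutFldS i (dirDomY i c) A) k) x‖ ≤ α₁ * ((geoCK i c).len (blkCubeY i c x))⁻¹) →
      (∀ (s : BlkCubeY i c) (lam : SiteY i → 𝔸),
        ‖(QpCubeY i c (parKnitCubeY i c) (cutCfgS i (dirDomY i c) (kGeo i).eta A) lam - QpCubeY i c (parKnitCubeY i c) (fun _ _ => 1) lam) s‖ ≤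
          Cq * α₁ * ∑ z, |qpKc i c s z| * ‖lam z‖) →
      (∀ (z : SiteY i) (nu : BlkCubeY i c → 𝔸),
        ‖(QpsCubeY i c (parKnitCubeY i c) (cutCfgS i (dirDomY i c) (kGeo i).eta A) nu - QpsCubeY i c (parKnitCubeY i c) (fun _ _ => 1) nu) z‖ ≤
          Cq * α₁ * ∑ s, |qpsKc i c z s| * ‖nu s‖) →
      IsUnit (dirPadY (indProjY (SBlk i c))
        (XCubeGY i c (parKnitCubeY i c) (GpDirY i c (parKnitCubeY i c) (dirDomY i c)) (cutCfgS i (dirDomY i c) (kGeo i).eta A))) ∧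
      HasMajorant (g := toB6 (geoCK i c) Rr H) (fun q : ↥(SBlk i c) × ι => (q.1 : BlkCubeY i c)) (CinvR b i c (cutCfgS i (dirDomY i c) (kGeo i).eta A))
        (fun a a' => B * (geoCK i c).len a ^ (-(4 : ℝ)) * Real.exp (-(δ * (geoCK i c).dist a a'))) := by
  classical
  obtain ⟨δ, B, M₀, T₀, N₀, hδ, hB, a₁, ha₁, hC⟩ := cor35_CDir_carrier₀ b d ℓ hℓ Cq M₂ hCq hM₂ hrepr h1
  obtain ⟨δG, BG, MG, TG, NG, -, -, aG, haG, BB, -, hG⟩ := cor35_GpDir_cube b d ℓ hℓ Cq M₂ hCq hM₂ hrepr h1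
  refine ⟨δ, B, max M₀ MG, max T₀ TG, max N₀ NG, hδ, hB, min a₁ aG, lt_min ha₁ haG, ?_⟩
  intro hd hL b₀ b₁ i c Rr H hM hN hT α₁ hα0 hα1 A hkF hsF h337B h337F h337Bτ hA hAτB hF hFs
  have hM0 : M₀ ≤ ((ℓ : ℝ) + 1) * (toKT i).Mh := (le_max_left _ _).trans hM
  have hMG : MG ≤ ((ℓ : ℝ) + 1) * (toKT i).Mh := (le_max_right _ _).trans hM
  have hN0 : N₀ + 1 ≤ (toKT i).R * ((ℓ + 1) * (toKT i).Mh) := le_trans (Nat.succ_le_succ (le_max_left _ _)) hN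
  have hNG : NG + 1 ≤ (toKT i).R * ((ℓ + 1) * (toKT i).Mh) := le_trans (Nat.succ_le_succ (le_max_right _ _)) hN
  have hT0 : T₀ ≤ RM1 i := (le_max_left _ _).trans hT
  have hTG : TG ≤ RM1 i := (le_max_right _ _).trans hT
  -- UNIT 2 (d): the word laws at the cut potential; n06-a: the `G`-word IS `conj b(η²(padΔ(Ṽ))⁻¹)` and `padΔ(Ṽ)` is a unit
  obtain ⟨-, -, -, -, hrest⟩ := hG i c Rr H (parKnitCubeY i c) (parKnitCubeY_one i c) hMG hNG hTG
  obtain ⟨hw1, hw2, -, -⟩ := hrest α₁ hα0 (hα1.trans (min_le_right _ _)) (chartA i (cutFldS i (dirDomY i c) A))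
    (kFCubeY i c (parKnitCubeY i c) (fun _ _ => 1) (cutCfgS i (dirDomY i c) (kGeo i).eta A))
    (sFCubeY i c (parKnitCubeY i c) (fun _ _ => 1) (cutCfgS i (dirDomY i c) (kGeo i).eta A)) hkF hsF h337B h337F h337Bτ hA hAτB
  have hS1 : ∀ z : SiteY i, 1 ≤ B9CubeLettersOpsL0.levCubeY i c z → z ∈ dirDomY i c := fun z hz =>
    mem_dirDomC_of_lev_pos hL.1 (oddMh i) (toKT i).hMh (toKT i).hP c hz
  have hcompr := compr_sub_compr_eq_cutCfgS i c hS1 (kGeo i).eta A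
  obtain ⟨hunit, hGext⟩ := GextDirK_eq_GpDirVK b i c (parKnitCubeY i c) A hcompr hw1 hw2
  -- the `C`-engine on the carrier at the same data
  obtain ⟨Tinv, hT1, hT2, hTm⟩ := hC i c Rr H hM0 hN0 hT0 α₁ hα0 (hα1.trans (min_le_left _ _)) (chartA i (cutFldS i (dirDomY i c) A))
    (kFCubeY i c (parKnitCubeY i c) (fun _ _ => 1) (cutCfgS i (dirDomY i c) (kGeo i).eta A))
    (sFCubeY i c (parKnitCubeY i c) (fun _ _ => 1) (cutCfgS i (dirDomY i c) (kGeo i).eta A)) (cutCfgS i (dirDomY i c) (kGeo i).eta A)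
    hkF hsF h337B hA hAτB hF hFs
  -- rewrite the engine's `G`-word as the padded inverse at the small field, then the block word as def-Y's
  have hGw := hGext
  unfold B9Cor36GpDirExtAtField.GextDirK B9Cor36GpDirExtAtField.VpDirK B9Cor36GpDirExtAtField.GpDirVK at hGw
  rw [hGw, word_at b i c _ hunit] at hT1 hT2
  obtain ⟨hUX, hTinv⟩ := eq_CinvR_of_laws b i c _ hT1 hT2
  exact ⟨hUX, hTinv ▸ hTm⟩


/-! ## v1.1 (append-only): the unit conclusion IS node00-def-Y's regime predicate of record -/

/-- the unit conclusion of `cor35_CDir_cube₀` IS def-Y's regime predicate `IsUnitXDirCubeY i □ Ω₀(□) Ṽ` (`blkProjY = indProjY`).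
[cite: Balaban1985BackgroundPropagators, (3.25) p.394 («positive operators»), p.409 l.1–5, dictionary] -/
theorem isUnitXDirCubeY_iff_isUnit_indProjY {hd : 1 ≤ d + 1} {hL : Odd (ℓ + 1) ∧ 1 < ℓ + 1} {b₀ b₁ : ℝ}
    (i : KIdx d ℓ hd hL b₀ b₁) (c : ↥(cubes (toKT i).D.toDomains)) (V : CfgY 𝔸 i) :
    Node00.OpsYCubeProjectionG.IsUnitXDirCubeY i c (dirDomY i c) V ↔
      IsUnit (dirPadY (indProjY (SBlk i c)) (XCubeGY i c (parKnitCubeY i c) (GpDirY i c (parKnitCubeY i c) (dirDomY i c)) V)) := by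
  unfold Node00.OpsYCubeProjectionG.IsUnitXDirCubeY
  rw [B9Eq3105DirichletBondLettersAtOneY.blkProjY_eq_indProjY i c]

end Literature.MathematicalPhysics.QuantumFieldTheory.Balaban1983to89.B9Cor35CDirCubeNoLegHyp
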